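import Literature.Analysis.FluidPDE.NSSereginEnergyLine
import Literature.Analysis.FluidPDE.NSLerayHopfSereginEnergyProofs
import HarnessLib

/-!
# Seregin 2012, Thm. 1.1 as printed (energy solutions, `a ∈ C^∞_{0,0}`): the named fact
# `seregin_L3_blowup_energy` from the slab initial layer

Analysis/FluidPDE proof file (theorems only: no definition, no named fact, no `sorry`).
`NSLerayHopfSereginProofs.lean` vendors Seregin's theorem verbatim as the named fact
`Literature.Analysis.FluidPDE.seregin_L3_blowup_energy` (G. Seregin, Comm. Math. Phys. 312 (2012)
833–845 = arXiv:1104.3615, **Thm. 1.1**: an energy solution from `a ∈ C^∞_{0,0}` with finite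
blow-up time `T` has `‖v(·,t)‖₃ → ∞` as `t ↑ T`), and `NSLerayHopfSereginEnergyProofs.lean` reduces
it (`seregin_L3_blowup_energy_of_leaves`) to Lemarié-Rieusset's Thm. 15.1 (C) (discharged,
`lemarieRieusset_singular_point_of_blowup_holds`) and the *Kato-class* core
`seregin_regular_of_liminf_L3`, whose cone rests on the extension step of the `E²` theory. The
energy solution of the fact has finite energy, so Seregin's own line applies to it: this file
proves the fact from the finite-energy core `isRegular_finalTime_of_frequently_eLpNorm_three_le`
(`NSSereginEnergyLine.lean`), i.e. from **U** (`local_leray_weak_strong_uniqueness`, discharged) and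
the uniform initial layer of local energy solutions with `L³` data on short strips:

* `seregin_L3_blowup_energy_of_U_of_layer`, `seregin_L3_blowup_energy_of_layer`.

Proof (Seregin 2012, §2 first paragraph; the identification with the mild solution as in
`seregin_L3_blowup_energy_of_leaves`): with `T_max` the Kato maximal time of `a`, `T ≤ T_max`
(else `(T_max, x₁)` would be a singular point inside the regular strip), so `v` coincides a.e. on
`(0, T) × ℝ³` with the Kato solution, which is essentially bounded on compact subsets of the open
strip (`IsKatoSolutionOn.eLpNorm_top_lt_top_of_isCompact`, `mild_L3_smooth_holds`): every point of
the open strip is regular in the centred sense; the Leray–Hopf class on `[0, T)` is `hv T`; if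
`‖v(t)‖₃ ↛ ∞` the core makes the given singular point `(T, x₀)` regular.

## References

* G. Seregin, Comm. Math. Phys. 312 (2012) 833–845 = arXiv:1104.3615, Thm. 1.1, §2.
  [Seregin2012CMP]
* P. G. Lemarié-Rieusset, *The Navier–Stokes Problem in the 21st Century* (2016), Thm. 15.1 (C),
  Thm. 14.7, Thm. 15.4, Prop. 12.3. [LemarieRieusset2016]
-/

noncomputable section

open MeasureTheory TopologicalSpace Set Function Filter Metric
open _root_.Topology
open scoped ENNReal NNReal RealInnerProductSpace

namespace Literature.Analysis.FluidPDE

/-- **Seregin 2012, Thm. 1.1 (`seregin_L3_blowup_energy`) from U and the slab initial layer.**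
See the module docstring. [cite: Seregin2012CMP, Thm. 1.1 and §2] [cite: LemarieRieusset2016, Thm. 15.1 (C), Thm. 14.7, Thm. 15.4] -/
theorem seregin_L3_blowup_energy_of_U_of_layer (hU : local_leray_weak_strong_uniqueness)
    (hlayer : ∀ M : ℝ≥0, ∃ S₁ : ℝ, 0 < S₁ ∧ ∀ T : ℝ, 0 < T → T ≤ S₁ →
      ∃ η : ℝ → ℝ≥0, Tendsto η (𝓝[>] 0) (𝓝 0) ∧
      ∀ (a : EuclideanSpace ℝ (Fin 3) → EuclideanSpace ℝ (Fin 3))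
        (v : ℝ → EuclideanSpace ℝ (Fin 3) → EuclideanSpace ℝ (Fin 3))
        (π : ℝ → EuclideanSpace ℝ (Fin 3) → ℝ),
        MemLp a 3 volume → eLpNorm a 3 volume ≤ M → IsLocalEnergySolutionOn T 1 a v π →
        ∀ t ∈ Ioo 0 T, ∀ x₀ : EuclideanSpace ℝ (Fin 3),
          eLpNorm (v t - heatTest 1 a t) 2 (volume.restrict (ball x₀ 1)) ≤ η t) :
    seregin_L3_blowup_energy := by
  intro ν T hν hT a v ha hac hdiv hv hreg hsing
  obtain ⟨x₀, hx₀⟩ := hsing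
  -- the datum: `L³`, weakly divergence free
  have ha3 : MemLp a 3 volume := ha.continuous.memLp_of_hasCompactSupport hac
  have hwdiv : IsWeaklyDivFree a :=
    VectorCalculus.IsDivFree.isWeaklyDivFree_holds hdiv (ha.of_le (mod_cast le_top))
  -- the Kato maximal time of `a`
  have hTm0 : 0 < katoMaximalTime ν a := katoMaximalTime_pos kato_local_holds hν ha3 hwdiv
  -- (i) `T ≤ T_max`
  have hTle : ENNReal.ofReal T ≤ katoMaximalTime ν a := by
    by_contra hlt
    rw [not_le] at hlt
    have htop : katoMaximalTime ν a < ⊤ := lt_of_lt_of_le hlt le_top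
    obtain ⟨u, hu⟩ := exists_isKatoSolutionOn_katoMaximalTime kato_unique_holds hν hTm0 htop
    set Tr : ℝ := (katoMaximalTime ν a).toReal with hTr_def
    have hTr0 : 0 < Tr := ENNReal.toReal_pos hTm0.ne' htop.ne
    have hofReal : ENNReal.ofReal Tr = katoMaximalTime ν a := ENNReal.ofReal_toReal htop.ne
    have hTrT : Tr < T := by
      rw [← hofReal] at hlt
      exact (ENNReal.ofReal_lt_ofReal_iff hT).1 hlt
    -- maximality of `T_max` in the Kato form
    have hmax : ∀ T'' : ℝ, Tr < T'' →
        ∀ w : ℝ → EuclideanSpace ℝ (Fin 3) → EuclideanSpace ℝ (Fin 3),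
          ¬ IsKatoSolutionOn T'' ν a w :=
      fun T'' hT'' w => not_isKatoSolutionOn_of_katoMaximalTime_lt (by
        rw [← hofReal]
        exact (ENNReal.ofReal_lt_ofReal_iff (hTr0.trans hT'')).2 hT'')
    -- the singular point of the maximal Kato solution at `T_max` …
    obtain ⟨x₁, hx₁⟩ := lemarieRieusset_singular_point_of_blowup_holds hν hTr0 ha3 hwdiv hu hmax
    have hall : ∀ r : ℝ, 0 < r →
        eLpNorm (uncurry u) (⊤ : ℝ≥0∞) (volume.restrict (parabolicCylinder r ((Tr : ℝ), x₁))) = ⊤ :=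
      fun r hr => eLpNorm_top_parabolicCylinder_eq_top_of_small hTr0 hx₁ hr
    -- … is a singular point of `v` at the time `T_max ∈ (0, T)`: excluded
    have hae : uncurry v =ᵐ[volume.restrict (Ioo 0 Tr ×ˢ univ)] uncurry u :=
      hv.ae_eq_uncurry_of_isKatoSolutionOn hν ha hac hdiv hTr0 hu
    obtain ⟨r, hr, hfin⟩ := hreg ((Tr : ℝ), x₁) ⟨hTr0, hTrT⟩
    exact hfin.ne (eLpNorm_parabolicCylinder_eq_top_of_ae_eq hTr0 hae x₁ hall hr)
  -- (ii) the Kato solution of `a` on `[0, T)`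
  obtain ⟨u, hu⟩ : ∃ u, IsKatoSolutionOn T ν a u := by
    rcases hTle.lt_or_eq with hlt | heq
    · exact exists_isKatoSolutionOn_of_ofReal_lt_katoMaximalTime hlt
    · have htop : katoMaximalTime ν a < ⊤ := by rw [← heq]; exact ENNReal.ofReal_lt_top
      obtain ⟨u, hu⟩ := exists_isKatoSolutionOn_katoMaximalTime kato_unique_holds hν hTm0 htop
      refine ⟨u, ?_⟩
      rwa [← heq, ENNReal.toReal_ofReal hT.le] at hu
  have hae : uncurry v =ᵐ[volume.restrict (Ioo 0 T ×ˢ univ)] uncurry u :=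
    hv.ae_eq_uncurry_of_isKatoSolutionOn hν ha hac hdiv hT hu
  -- every point of the open strip is regular in the centred sense (`v = u` a.e., `u` smooth)
  have hregC : ∀ t ∈ Ioo 0 T, ∀ x : EuclideanSpace ℝ (Fin 3), IsRegularPoint v (t, x) := by
    intro t ht x
    set m : ℝ := min t (T - t) with hm
    have hmpos : 0 < m := lt_min ht.1 (by linarith [ht.2])
    set r : ℝ := Real.sqrt (m / 2) with hr
    have hrpos : 0 < r := Real.sqrt_pos.2 (by positivity)
    have hr2 : r ^ 2 = m / 2 := by rw [hr, Real.sq_sqrt (by positivity)]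
    have h1 : r ^ 2 < t := by rw [hr2]; linarith [min_le_left t (T - t)]
    have h2 : t + r ^ 2 < T := by rw [hr2]; linarith [min_le_right t (T - t)]
    set K : Set (ℝ × EuclideanSpace ℝ (Fin 3)) := Icc (t - r ^ 2) (t + r ^ 2) ×ˢ closedBall x r
      with hK_def
    have hK : IsCompact K := isCompact_Icc.prod (isCompact_closedBall _ _)
    have hKsub : K ⊆ Ioo 0 T ×ˢ (univ : Set (EuclideanSpace ℝ (Fin 3))) := fun z hz =>
      ⟨⟨by linarith [hz.1.1], by linarith [hz.1.2]⟩, mem_univ _⟩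
    have hQK : parabolicCylinderCentered r ((t : ℝ), x) ⊆ K := fun z hz =>
      ⟨Ioo_subset_Icc_self hz.1, ball_subset_closedBall hz.2⟩
    have hKu : eLpNorm (uncurry u) ∞ (volume.restrict K) < ∞ :=
      hu.eLpNorm_top_lt_top_of_isCompact mild_L3_smooth_holds hν hK hKsub
    have hKv : eLpNorm (uncurry v) ∞ (volume.restrict K) = eLpNorm (uncurry u) ∞ (volume.restrict K) :=
      eLpNorm_congr_ae (ae_restrict_of_ae_restrict_of_subset hKsub hae)
    refine ⟨r, hrpos, lt_of_le_of_lt (eLpNorm_mono_measure _ (Measure.restrict_mono hQK le_rfl)) ?_⟩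
    rw [hKv]
    exact hKu
  -- if `‖v(t)‖₃ ↛ ∞`, some level `M` is undershot frequently, and the core makes `(T, x₀)` regular
  rw [ENNReal.tendsto_nhds_top_iff_nnreal]
  by_contra hnot
  obtain ⟨M, hM⟩ := not_forall.1 hnot
  have hfreq : ∃ᶠ t in 𝓝[<] T, eLpNorm (v t) 3 volume ≤ M :=
    (not_eventually.1 hM).mono fun t ht => not_lt.1 ht
  obtain ⟨r, hr, hfin⟩ := isRegular_finalTime_of_frequently_eLpNorm_three_le hU hlayer hν hT
    (hv T hT) hregC ⟨M, hfreq⟩ x₀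
  exact hfin.ne (hx₀ r hr)

/-- **Seregin 2012, Thm. 1.1 (`seregin_L3_blowup_energy`) from the slab initial layer alone** (U
discharged, `local_leray_weak_strong_uniqueness_holds`). [cite: Seregin2012CMP, Thm. 1.1] -/
theorem seregin_L3_blowup_energy_of_layer
    (hlayer : ∀ M : ℝ≥0, ∃ S₁ : ℝ, 0 < S₁ ∧ ∀ T : ℝ, 0 < T → T ≤ S₁ →
      ∃ η : ℝ → ℝ≥0, Tendsto η (𝓝[>] 0) (𝓝 0) ∧
      ∀ (a : EuclideanSpace ℝ (Fin 3) → EuclideanSpace ℝ (Fin 3))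
        (v : ℝ → EuclideanSpace ℝ (Fin 3) → EuclideanSpace ℝ (Fin 3))
        (π : ℝ → EuclideanSpace ℝ (Fin 3) → ℝ),
        MemLp a 3 volume → eLpNorm a 3 volume ≤ M → IsLocalEnergySolutionOn T 1 a v π →
        ∀ t ∈ Ioo 0 T, ∀ x₀ : EuclideanSpace ℝ (Fin 3),
          eLpNorm (v t - heatTest 1 a t) 2 (volume.restrict (ball x₀ 1)) ≤ η t) :
    seregin_L3_blowup_energy :=
  seregin_L3_blowup_energy_of_U_of_layer local_leray_weak_strong_uniqueness_holds hlayer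

end Literature.Analysis.FluidPDE

end
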